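import Summits.AtomisticToContinuum.HydrodynamicLimit.Theorems.AntiMazurCoboundariesCellForecastPressureDecayObjects
import Literature.Probability.LatticeModels.UrsellInversion
import Literature.Probability.LatticeModels.ClusterExpansion
import HarnessLib

/-!
# Stub `stub_polymerRepresentation` of the crux line `tilt-analyticity-transfer`
(crux `AntiMazurCoboundaries.CellForecastPressureDecay`, stmt-AtomisticToContinuum-13915)

Helper file of the line (`--supports stmt-AtomisticToContinuum-13915`); objects imported from
`Theorems/AntiMazurCoboundariesCellForecastPressureDecayObjects.lean` (namespace `…Theorems.TiltAnalyticity`, p80905).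

## Content

* `cumulantOfMoments_eq_ursellOf`: the anchored cumulants of the objects module ARE the Ursell
  (truncated) functions of the tree (`Literature.Probability.LatticeModels.ursellOf`) as soon as
  `m ∅ = 1` (strong induction on the index set, comparing the anchored recursion with the block
  form `sum_ursellOf_mul_eq` of the cluster decomposition at the least element);
* `sum_powerset_eq_subsetGasZ`: the purely combinatorial polymer representation
  `Σ_{A ⊆ S} m(A) = Ξ_S(ursellOf m)` (`m ∅ = 1`), `Ξ_S` the hard-core subset polymer gas
  `subsetGasZ`: both sides satisfy the same recursion in `S` — for the left side this is the
  block form of the cluster decomposition at a fixed label `s ∈ S` and a resummation, for the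
  right side the deletion of the clique of polymers containing `s`
  (`polymerPartitionFunction_eq_sdiff_add_sum`);
* `stub_polymerRepresentation` (registered stub S2a): `E ∏_{j∈S}(1+u_j) = Ξ_S(κ)` with `κ` the
  joint cumulants, by expanding the product (`Finset.prod_one_add`) and integrating termwise.
-/

noncomputable section

open MeasureTheory Set Metric Filter ProbabilityTheory Topology
open scoped ENNReal BigOperators
open Literature.Analysis.FluidPDE Literature.MathematicalPhysics.KineticTheory
open Literature.Probability.LatticeModels (polymerPartitionFunction polymerPartitionFunction_empty
  polymerPartitionFunction_eq_sdiff_add_sum ursellOf ursellOf_eq sum_ursellOf_mul_eq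
  setPartitions_empty)

namespace Summit.AtomisticToContinuum.HydrodynamicLimit.Theorems.TiltAnalyticity

/-! ## The anchored cumulants are the Ursell functions -/

/-- **Bridge to the tree's Ursell functions**: for a moment function with `m ∅ = 1`, the anchored
cumulants `cumulantOfMoments m` coincide with the Möbius-inverted Ursell functions `ursellOf m`
(uniqueness of the solution of the anchored moment–cumulant relations). -/
theorem cumulantOfMoments_eq_ursellOf {ι : Type*} [LinearOrder ι] (m : Finset ι → ℂ)
    (hm0 : m ∅ = 1) (B : Finset ι) : cumulantOfMoments m B = ursellOf m B := by
  induction B using Finset.strongInduction with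
  | H B ih =>
    rcases B.eq_empty_or_nonempty with rfl | hB
    · rw [cumulantOfMoments_empty, ursellOf_eq, setPartitions_empty,
        Finset.erase_eq_of_notMem (by simp), Finset.sum_singleton, Finset.prod_empty, hm0, sub_self]
    · have h2 := sum_ursellOf_mul_eq m hm0 (B.min'_mem hB)
      have hBmem : B ∈ B.powerset.filter (fun P => B.min' hB ∈ P) :=
        Finset.mem_filter.2 ⟨Finset.mem_powerset.2 subset_rfl, B.min'_mem hB⟩
      rw [← Finset.add_sum_erase _ _ hBmem, Finset.sdiff_self, hm0, mul_one] at h2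
      have hset : (B.powerset.filter (fun P => B.min' hB ∈ P)).erase B =
          B.powerset.filter (fun A => A ⊂ B ∧ B.min' hB ∈ A) := by
        ext A
        simp only [Finset.mem_erase, Finset.mem_filter, Finset.mem_powerset,
          Finset.ssubset_iff_subset_ne]
        tauto
      rw [cumulantOfMoments_eq m hB, eq_sub_of_add_eq h2, hset]
      congr 1
      refine Finset.sum_congr rfl fun A hA => ?_
      rw [ih A (Finset.mem_filter.1 hA).2.1]

/-- On a probability space the empty moment is `1`. -/
theorem momentOf_empty {Ω ι : Type*} [MeasurableSpace Ω] (P : Measure Ω)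
    [IsProbabilityMeasure P] (u : ι → Ω → ℂ) : momentOf P u ∅ = 1 := by
  simp [momentOf]

/-- On a probability space the joint cumulants are the Ursell functions of the moments. -/
theorem jointCumulant_eq_ursellOf {Ω ι : Type*} [MeasurableSpace Ω] [LinearOrder ι]
    (P : Measure Ω) [IsProbabilityMeasure P] (u : ι → Ω → ℂ) :
    jointCumulant P u = ursellOf (momentOf P u) :=
  funext fun B => cumulantOfMoments_eq_ursellOf _ (momentOf_empty P u) B

/-! ## The subset polymer gas: empty volume and the deletion recursion -/

section Combinatorics

variable {ι : Type*} [DecidableEq ι]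

/-- `Ξ_∅ = 1`: the subset polymer gas on no labels has only the empty family. -/
theorem subsetGasZ_empty (κ : Finset ι → ℂ) : subsetGasZ κ ∅ = 1 := by
  unfold subsetGasZ
  rw [Finset.powerset_empty, Finset.filter_singleton, if_neg Finset.not_nonempty_empty,
    polymerPartitionFunction_empty]

/-- **Deletion recursion of the subset polymer gas** at a label `s` (trivial unless `s ∈ S`): a
pairwise disjoint family of nonempty subsets of `S` either avoids `s` (a family on `S.erase s`) or
contains exactly one polymer `D ∋ s`, the rest being a family on `S ∖ D`:
`Ξ_S = Ξ_{S ∖ s} + Σ_{s ∈ D ⊆ S} κ(D) Ξ_{S ∖ D}` (the polymers containing `s` form a clique of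
the overlap relation; `polymerPartitionFunction_eq_sdiff_add_sum`). -/
theorem subsetGasZ_eq_erase_add_sum (κ : Finset ι → ℂ) (S : Finset ι) (s : ι) :
    subsetGasZ κ S = subsetGasZ κ (S.erase s) +
      ∑ D ∈ S.powerset.filter (fun D => s ∈ D), κ D * subsetGasZ κ (S \ D) := by
  haveI : Std.Symm (Overlap (ι := ι)) := ⟨overlap_symm⟩
  have hD : S.powerset.filter (fun D => s ∈ D) ⊆ S.powerset.filter Finset.Nonempty :=
    fun D hD' =>
      Finset.mem_filter.2 ⟨(Finset.mem_filter.1 hD').1, ⟨s, (Finset.mem_filter.1 hD').2⟩⟩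
  have hclique : ∀ D ∈ S.powerset.filter (fun D => s ∈ D),
      ∀ D' ∈ S.powerset.filter (fun D => s ∈ D), D ≠ D' → Overlap D D' :=
    fun D hD D' hD' _ => Or.inl fun h =>
      Finset.disjoint_left.1 h (Finset.mem_filter.1 hD).2 (Finset.mem_filter.1 hD').2
  have hsd : S.powerset.filter Finset.Nonempty \ S.powerset.filter (fun D => s ∈ D) =
      (S.erase s).powerset.filter Finset.Nonempty := by
    ext B
    simp only [Finset.mem_sdiff, Finset.mem_filter, Finset.mem_powerset, Finset.subset_erase]
    tauto
  unfold subsetGasZ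
  rw [polymerPartitionFunction_eq_sdiff_add_sum κ hD hclique, hsd]
  congr 1
  refine Finset.sum_congr rfl fun D hD' => ?_
  obtain ⟨-, hsD⟩ := Finset.mem_filter.1 hD'
  congr 2
  ext B
  simp only [Finset.mem_filter, Finset.mem_powerset, Finset.subset_erase, Finset.subset_sdiff,
    Overlap, not_or, not_not]
  constructor
  · rintro ⟨⟨⟨hBS, -⟩, hBne⟩, hdisj, -⟩
    exact ⟨⟨hBS, hdisj.symm⟩, hBne⟩
  · rintro ⟨⟨hBS, hdisj⟩, hBne⟩
    refine ⟨⟨⟨hBS, fun hsB => Finset.disjoint_left.1 hdisj hsB hsD⟩, hBne⟩, hdisj.symm,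
      ?_⟩
    rintro rfl
    exact hBne.ne_empty ((Finset.disjoint_self_iff_empty _).1 hdisj)

/-- **The same recursion for the subset sums of the moments**: for `m ∅ = 1` and a label `s`,
`Σ_{A ⊆ S} m(A) = Σ_{A ⊆ S ∖ s} m(A) + Σ_{s ∈ D ⊆ S} mᵀ(D) · Σ_{E ⊆ S ∖ D} m(E)`:
the subsets `A ∋ s` are expanded by the block form of the cluster decomposition at `s`
(`sum_ursellOf_mul_eq`) and the double sum over `(A, D)`, `s ∈ D ⊆ A ⊆ S`, is re-indexed by
`(D, E = A ∖ D)`. -/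
theorem sum_powerset_eq_erase_add_sum (m : Finset ι → ℂ) (hm0 : m ∅ = 1) (S : Finset ι)
    (s : ι) :
    ∑ A ∈ S.powerset, m A = ∑ A ∈ (S.erase s).powerset, m A +
      ∑ D ∈ S.powerset.filter (fun D => s ∈ D),
        ursellOf m D * ∑ E ∈ (S \ D).powerset, m E := by
  rw [← Finset.sum_filter_add_sum_filter_not S.powerset (fun A => s ∈ A), add_comm]
  congr 1
  · refine Finset.sum_congr ?_ fun _ _ => rfl
    ext A
    simp only [Finset.mem_filter, Finset.mem_powerset, Finset.subset_erase]
  · calc ∑ A ∈ S.powerset.filter (fun A => s ∈ A), m A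
        = ∑ A ∈ S.powerset.filter (fun A => s ∈ A),
            ∑ D ∈ A.powerset.filter (fun P => s ∈ P), ursellOf m D * m (A \ D) :=
          Finset.sum_congr rfl fun A hA =>
            (sum_ursellOf_mul_eq m hm0 (Finset.mem_filter.1 hA).2).symm
      _ = ∑ D ∈ S.powerset.filter (fun D => s ∈ D),
            ∑ E ∈ (S \ D).powerset, ursellOf m D * m E := by
          rw [Finset.sum_sigma', Finset.sum_sigma']
          refine Finset.sum_nbij' (fun x => ⟨x.2, x.1 \ x.2⟩) (fun y => ⟨y.1 ∪ y.2, y.1⟩)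
            ?_ ?_ ?_ ?_ ?_
          · rintro ⟨A, D⟩ h
            simp only [Finset.mem_sigma, Finset.mem_filter, Finset.mem_powerset] at h ⊢
            exact ⟨⟨h.2.1.trans h.1.1, h.2.2⟩, Finset.sdiff_subset_sdiff h.1.1 subset_rfl⟩
          · rintro ⟨D, E⟩ h
            simp only [Finset.mem_sigma, Finset.mem_filter, Finset.mem_powerset,
              Finset.subset_sdiff] at h ⊢
            exact ⟨⟨Finset.union_subset h.1.1 h.2.1, Finset.mem_union_left _ h.1.2⟩,
              Finset.subset_union_left, h.1.2⟩
          · rintro ⟨A, D⟩ h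
            simp only [Finset.mem_sigma, Finset.mem_filter, Finset.mem_powerset] at h
            simp only [Finset.union_sdiff_of_subset h.2.1]
          · rintro ⟨D, E⟩ h
            simp only [Finset.mem_sigma, Finset.mem_filter, Finset.mem_powerset,
              Finset.subset_sdiff] at h
            simp only [Finset.union_sdiff_cancel_left h.2.2.symm]
          · rintro ⟨A, D⟩ _
            rfl
      _ = _ := Finset.sum_congr rfl fun D _ => (Finset.mul_sum _ _ _).symm

/-- **Polymer representation, combinatorial form**: for a moment function with `m ∅ = 1`,
`Σ_{A ⊆ S} m(A) = Ξ_S(mᵀ)`, the partition function of the hard-core subset polymer gas on `S` with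
the Ursell functions as activities (strong induction on `S` with the two deletion recursions
`sum_powerset_eq_erase_add_sum` and `subsetGasZ_eq_erase_add_sum` at a label `s ∈ S`). -/
theorem sum_powerset_eq_subsetGasZ (m : Finset ι → ℂ) (hm0 : m ∅ = 1) (S : Finset ι) :
    ∑ A ∈ S.powerset, m A = subsetGasZ (ursellOf m) S := by
  induction S using Finset.strongInduction with
  | H S ih =>
    rcases S.eq_empty_or_nonempty with rfl | ⟨s, hs⟩
    · rw [Finset.powerset_empty, Finset.sum_singleton, hm0, subsetGasZ_empty]
    · rw [sum_powerset_eq_erase_add_sum m hm0 S s, subsetGasZ_eq_erase_add_sum _ S s,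
        ih _ (Finset.erase_ssubset hs)]
      congr 1
      refine Finset.sum_congr rfl fun D hD => ?_
      obtain ⟨hDS, hsD⟩ := Finset.mem_filter.1 hD
      rw [ih _ (Finset.sdiff_ssubset (Finset.mem_powerset.1 hDS) ⟨s, hsD⟩)]

end Combinatorics

/-! ## The registered stub -/

/-- **Registered stub S2a `stub_polymerRepresentation`** (line `tilt-analyticity-transfer`, crux
stmt-AtomisticToContinuum-13915): POLYMER REPRESENTATION OF LABEL MOMENTS — for bounded measurable complex
variables `u_j` on a probability space and every label set `S`,
`E ∏_{j∈S} (1 + u_j) = subsetGasZ (jointCumulant P u) S`. [folklore] -/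
theorem stub_polymerRepresentation :
    ∀ (Ω : Type) [MeasurableSpace Ω] (P : Measure Ω) [IsProbabilityMeasure P] (n : ℕ)
      (u : Fin n → Ω → ℂ) (C : ℝ), (∀ j, Measurable (u j)) → (∀ j ω, ‖u j ω‖ ≤ C) →
      ∀ S : Finset (Fin n), ∫ ω, ∏ j ∈ S, (1 + u j ω) ∂P = subsetGasZ (jointCumulant P u) S := by
  intro Ω _ P _ n u C hu hC S
  rw [jointCumulant_eq_ursellOf, ← sum_powerset_eq_subsetGasZ _ (momentOf_empty P u)]
  simp_rw [Finset.prod_one_add]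
  rw [integral_finsetSum]
  · rfl
  · intro A _
    refine (integrable_const (C ^ A.card)).mono'
      (Finset.measurable_prod A fun j _ => hu j).aestronglyMeasurable
      (Eventually.of_forall fun ω => ?_)
    rw [norm_prod, ← Finset.prod_const]
    exact Finset.prod_le_prod (fun j _ => norm_nonneg _) fun j _ => hC j ω

end Summit.AtomisticToContinuum.HydrodynamicLimit.Theorems.TiltAnalyticity

end
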